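import Summits.QuantumFields.BalabanUV.Beta.GAN24.EnlargedCapacitance
import Summits.QuantumFields.BalabanUV.Beta.GAN24.GoodAliasStrip
import Summits.QuantumFields.BalabanUV.Beta.GAN24.ZeroAliasPinning
import Summits.QuantumFields.BalabanUV.Beta.GAN24.ZeroAliasBounds

/-!
# `BalabanUV.Beta.GAN24.EnlargedInjective` — binder row G-an2-4 / (CONV-C), road P1-fibre (p1's L10, (U1) ON THE CONE REGION): `det F_N(p) ≠ 0` for complex `p` with
# `‖p_κ‖ ≤ r` on the strip, from the zero-alias pinning lemma — ALL zero-alias inputs discharged; the three GOOD-capacitance alias-sum bounds are the hypotheses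

NOT IN PRINT; OUR PROOF ATTEMPT.  HONEST FRAMING (cell contract, verbatim): «discharging `BetaPertH` makes Bałaban's UV stability UNCONDITIONAL — a real
constructive-QFT result; it is NOT the continuum limit and NOT the Clay problem.»  HONEST DEPENDENCY (verbatim): «continuum YM on T⁴ ⇐ BetaPertH ∧ nine spine
estimates (0/9 proved); BetaPertH ⇐ (D1) ∧ (D4) ∧ CAP+tail; G-an2-4 gates asym, D1 and NE2/3/4.»  [folklore] assembly (no cited fact, no wall binder, no `def`).
NOT summit progress; nothing of (CONV-C)'s K-slot is discharged here.

## What is proved (generic `D`, `N ≥ 1`)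
For complex `p` with `‖p_κ‖ ≤ r ≤ 1/2` and `p ∈ Strip D κ`, `κ ≤ 1`, `2Dκ² < 4` (so `hL′` holds: `GoodAliasStrip.hL'_of_strip`), and bounds `P, V, W` on the GOOD capacitance of
`EnlargedCapacitance.goodFibre p hL′` (`Σ_κ ‖capP κ l‖ ≤ P`, `Σ_κ ‖capV κ‖ ≤ V`, `‖capW κ‖ ≤ W`): with the zero-alias numbers of `ZeroAliasBounds` —
`ℓ = 4Dr²/N²`, `δ = 2r/N`, `e = (1/2)^{D+1}·N`, `g = (1/2)^D`, `q = ((1/2)·N)^{D+1}`, `m = ((1/2)·N)^D` — the two smallness conditions of `ZeroAliasPinning.pinning`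
imply: **`enl_injective`** (the homogeneous enlarged system has only the trivial solution), **`det_fibreMatrix_ne_zero`**, **`det_trigPolySymbol_ne_zero`**
(= the `hdet` input of `StripRegularPackaging` at this `p`).  With `P = P̄N^{D+4}r²`, `V = V̄N^{D+4}r³`, `W = W̄N^{D+4}r³` (L06/Y08s-type sums at complex momenta — the
remaining hypotheses) every power of `N` cancels in the two conditions (`θ_c = 2^{2D+4}DV̄r⁶`, `Θ = 2^{2D+6}Dr²(P̄r² + V̄r³K̄) + 2^{2D+4}D²W̄r⁶`): (U1) holds on
`{‖p_κ‖ ≤ r₀} ∩ Strip` UNIFORMLY IN `N` — the cone region where the plain closed form has poles.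
Unit `b2b-balaban-gan24-formalise-leaf-06` (G-an2-4 formalisation swarm), 2026-08-20.
-/

noncomputable section

open Complex Finset
open scoped BigOperators
open Literature.MathematicalPhysics.QuantumFieldTheory.Balaban1983to89
open Literature.MathematicalPhysics.QuantumFieldTheory.Balaban1983to89.Beta
open Literature.Probability.LatticeModels (TorusSite)
open B4Strip (Strip)
open BlochFibreMatrix (blochChar fibreMatrix stencil pieceMatrix)
open FibreInverseDecay (trigPolySymbol)
open Summit.QuantumFields.BalabanUV.Beta.GAN24.FibreSymbols (lapSym)
open Summit.QuantumFields.BalabanUV.Beta.GAN24.FibreDFT (kFine)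
open Summit.QuantumFields.BalabanUV.Beta.GAN24.CapacitanceSolve (capP capV capW)
open Summit.QuantumFields.BalabanUV.Beta.GAN24.EnlargedCapacitance (Good goodFibre zeroAlias EnlSolves det_fibreMatrix_ne_zero_of_enl_injective
  det_trigPolySymbol_ne_zero_of_enl_injective)
open Summit.QuantumFields.BalabanUV.Beta.GAN24.GoodAliasStrip (hL'_of_strip)
open Summit.QuantumFields.BalabanUV.Beta.GAN24.ZeroAliasPinning (pinning_enl)
open Summit.QuantumFields.BalabanUV.Beta.GAN24.ZeroAliasBounds (norm_dhat_zero_le norm_dflat_zero_le norm_lapSym_zero_le norm_boxS_zero_ge norm_boxSs_zero_ge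
  norm_chiHat_zero_ge norm_wE_zero_ge)

namespace Summit.QuantumFields.BalabanUV.Beta.GAN24.EnlargedInjective

variable {D N : ℕ} [NeZero N]

/-- [folklore] `(1/2)^n ≤ (1 − r)^n` for `r ≤ 1/2`. -/
theorem half_pow_le {r : ℝ} (hr : r ≤ 1 / 2) (n : ℕ) : (1 / 2 : ℝ) ^ n ≤ (1 - r) ^ n :=
  pow_le_pow_left₀ (by norm_num) (by linarith) n

/-- [folklore] **(U1) ON THE CONE REGION — THE HOMOGENEOUS ENLARGED SYSTEM IS TRIVIAL** under the two pinning conditions with the zero-alias numbers of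
`ZeroAliasBounds` plugged in and the good-capacitance bounds `P, V, W` as hypotheses. -/
theorem enl_injective (p : Fin D → ℂ) {r κc : ℝ} (hp : ∀ κ, ‖p κ‖ ≤ r) (hr0 : 0 ≤ r) (hr : r ≤ 1 / 2)
    (hκ1 : κc ≤ 1) (hD : 2 * D * κc ^ 2 < 4) (hs : p ∈ Strip D κc)
    {P V W : ℝ} (hP0 : 0 ≤ P) (hV0 : 0 ≤ V)
    (hP : ∀ l, ∑ κ, ‖capP (goodFibre p (hL'_of_strip (N := N) hκ1 hD hs)) κ l‖ ≤ P)
    (hV : ∑ κ, ‖capV (goodFibre p (hL'_of_strip (N := N) hκ1 hD hs)) κ‖ ≤ V)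
    (hW : ∀ κ, ‖capW (goodFibre p (hL'_of_strip (N := N) hκ1 hD hs)) κ‖ ≤ W)
    (hθ : (4 * D * r ^ 2 / (N : ℝ) ^ 2) * (2 * r / N) * V < (1 / 2 : ℝ) ^ D * ((1 / 2 : ℝ) * N) ^ (D + 1))
    (hΘ : (2 * (4 * D * r ^ 2 / (N : ℝ) ^ 2 + D * (2 * r / N) * (2 * r / N)) *
            (P + V * ((4 * D * r ^ 2 / (N : ℝ) ^ 2) * (2 * r / N) * P /
              ((1 / 2 : ℝ) ^ D * ((1 / 2 : ℝ) * N) ^ (D + 1) - (4 * D * r ^ 2 / (N : ℝ) ^ 2) * (2 * r / N) * V))) / (((1 / 2 : ℝ) * N) ^ (D + 1))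
          + D * (4 * D * r ^ 2 / (N : ℝ) ^ 2) * (2 * r / N) * W / (((1 / 2 : ℝ) * N) ^ D)) / ((1 / 2 : ℝ) ^ (D + 1) * N) < 1)
    {A0 : Fin D → ℂ} {μ0 : ℂ} {φ : Fin D → ℂ} {c : ℂ}
    (h : EnlSolves (goodFibre p (hL'_of_strip (N := N) hκ1 hD hs)) (zeroAlias (N := N) p) 0 0 0 0 0 0 A0 μ0 φ c) :
    A0 = 0 ∧ μ0 = 0 ∧ φ = 0 ∧ c = 0 := by
  have hr1 : r ≤ 1 := by linarith
  have hN0 : (0 : ℝ) < N := by exact_mod_cast Nat.pos_of_ne_zero (NeZero.ne N)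
  obtain ⟨hE, hG, hQ, hM⟩ := h
  refine pinning_enl (goodFibre p (hL'_of_strip (N := N) hκ1 hD hs))
    (L0 := lapSym (kFine p (0 : TorusSite D N))) (norm_lapSym_zero_le hp hr0 hr1) (norm_dhat_zero_le hp hr1) (norm_dflat_zero_le hp hr1)
    (e := (1 / 2 : ℝ) ^ (D + 1) * N) (by positivity) (fun κ => ?_) (g := (1 / 2 : ℝ) ^ D) (by positivity) ?_
    (q := ((1 / 2 : ℝ) * N) ^ (D + 1)) (by positivity) (fun κ => ?_) (m := ((1 / 2 : ℝ) * N) ^ D) (by positivity) ?_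
    hP hV hW (by positivity) (by positivity) (by positivity) hP0 hV0 hθ hΘ hE hG hQ hM
  · exact (mul_le_mul_of_nonneg_right (half_pow_le hr (D + 1)) hN0.le).trans (norm_wE_zero_ge hp hr1 κ)
  · exact (half_pow_le hr D).trans (norm_chiHat_zero_ge hp hr1)
  · calc ((1 / 2 : ℝ) * N) ^ (D + 1) ≤ ((1 - r) * N) ^ (D + 1) :=
          pow_le_pow_left₀ (by positivity) (mul_le_mul_of_nonneg_right (by linarith) hN0.le) _
      _ ≤ _ := norm_boxSs_zero_ge hp hr1 κ
  · calc ((1 / 2 : ℝ) * N) ^ D ≤ ((1 - r) * N) ^ D :=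
          pow_le_pow_left₀ (by positivity) (mul_le_mul_of_nonneg_right (by linarith) hN0.le) _
      _ ≤ _ := norm_boxS_zero_ge hp hr1

/-- [folklore] **(U1) ON THE CONE REGION**: `det (fibreMatrix (blochChar p)) ≠ 0`. -/
theorem det_fibreMatrix_ne_zero (p : Fin D → ℂ) {r κc : ℝ} (hp : ∀ κ, ‖p κ‖ ≤ r) (hr0 : 0 ≤ r) (hr : r ≤ 1 / 2)
    (hκ1 : κc ≤ 1) (hD : 2 * D * κc ^ 2 < 4) (hs : p ∈ Strip D κc)
    {P V W : ℝ} (hP0 : 0 ≤ P) (hV0 : 0 ≤ V)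
    (hP : ∀ l, ∑ κ, ‖capP (goodFibre p (hL'_of_strip (N := N) hκ1 hD hs)) κ l‖ ≤ P)
    (hV : ∑ κ, ‖capV (goodFibre p (hL'_of_strip (N := N) hκ1 hD hs)) κ‖ ≤ V)
    (hW : ∀ κ, ‖capW (goodFibre p (hL'_of_strip (N := N) hκ1 hD hs)) κ‖ ≤ W)
    (hθ : (4 * D * r ^ 2 / (N : ℝ) ^ 2) * (2 * r / N) * V < (1 / 2 : ℝ) ^ D * ((1 / 2 : ℝ) * N) ^ (D + 1))
    (hΘ : (2 * (4 * D * r ^ 2 / (N : ℝ) ^ 2 + D * (2 * r / N) * (2 * r / N)) *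
            (P + V * ((4 * D * r ^ 2 / (N : ℝ) ^ 2) * (2 * r / N) * P /
              ((1 / 2 : ℝ) ^ D * ((1 / 2 : ℝ) * N) ^ (D + 1) - (4 * D * r ^ 2 / (N : ℝ) ^ 2) * (2 * r / N) * V))) / (((1 / 2 : ℝ) * N) ^ (D + 1))
          + D * (4 * D * r ^ 2 / (N : ℝ) ^ 2) * (2 * r / N) * W / (((1 / 2 : ℝ) * N) ^ D)) / ((1 / 2 : ℝ) ^ (D + 1) * N) < 1) :
    (fibreMatrix (N := N) (⇑(blochChar p))).det ≠ 0 :=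
  det_fibreMatrix_ne_zero_of_enl_injective p _ fun _ _ _ _ h => enl_injective p hp hr0 hr hκ1 hD hs hP0 hV0 hP hV hW hθ hΘ h

/-- [folklore] The same in `trigPolySymbol (stencil (d+1)) pieceMatrix` currency (the `hdet` binder of `StripRegularPackaging` at this `p`). -/
theorem det_trigPolySymbol_ne_zero {d : ℕ} (p : Fin (d + 1) → ℂ) {r κc : ℝ} (hp : ∀ κ, ‖p κ‖ ≤ r) (hr0 : 0 ≤ r) (hr : r ≤ 1 / 2)
    (hκ1 : κc ≤ 1) (hD : 2 * ((d + 1 : ℕ) : ℝ) * κc ^ 2 < 4) (hs : p ∈ Strip (d + 1) κc)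
    {P V W : ℝ} (hP0 : 0 ≤ P) (hV0 : 0 ≤ V)
    (hP : ∀ l, ∑ κ, ‖capP (goodFibre p (hL'_of_strip (N := N) hκ1 hD hs)) κ l‖ ≤ P)
    (hV : ∑ κ, ‖capV (goodFibre p (hL'_of_strip (N := N) hκ1 hD hs)) κ‖ ≤ V)
    (hW : ∀ κ, ‖capW (goodFibre p (hL'_of_strip (N := N) hκ1 hD hs)) κ‖ ≤ W)
    (hθ : (4 * ((d + 1 : ℕ) : ℝ) * r ^ 2 / (N : ℝ) ^ 2) * (2 * r / N) * V < (1 / 2 : ℝ) ^ (d + 1) * ((1 / 2 : ℝ) * N) ^ (d + 1 + 1))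
    (hΘ : (2 * (4 * ((d + 1 : ℕ) : ℝ) * r ^ 2 / (N : ℝ) ^ 2 + ((d + 1 : ℕ) : ℝ) * (2 * r / N) * (2 * r / N)) *
            (P + V * ((4 * ((d + 1 : ℕ) : ℝ) * r ^ 2 / (N : ℝ) ^ 2) * (2 * r / N) * P /
              ((1 / 2 : ℝ) ^ (d + 1) * ((1 / 2 : ℝ) * N) ^ (d + 1 + 1) - (4 * ((d + 1 : ℕ) : ℝ) * r ^ 2 / (N : ℝ) ^ 2) * (2 * r / N) * V))) /
              (((1 / 2 : ℝ) * N) ^ (d + 1 + 1))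
          + ((d + 1 : ℕ) : ℝ) * (4 * ((d + 1 : ℕ) : ℝ) * r ^ 2 / (N : ℝ) ^ 2) * (2 * r / N) * W / (((1 / 2 : ℝ) * N) ^ (d + 1))) /
            ((1 / 2 : ℝ) ^ (d + 1 + 1) * N) < 1) :
    (trigPolySymbol (stencil (d + 1)) (pieceMatrix (N := N)) p).det ≠ 0 :=
  det_trigPolySymbol_ne_zero_of_enl_injective p _ fun _ _ _ _ h => enl_injective p hp hr0 hr hκ1 hD hs hP0 hV0 hP hV hW hθ hΘ h

end Summit.QuantumFields.BalabanUV.Beta.GAN24.EnlargedInjective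

end
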